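import Mathlib
import HarnessLib
import Summits.Ventures.LatticeQCDFlow.Exactness.IMHCoupledTimeAverageBernstein
import Summits.Ventures.LatticeQCDFlow.Scaling.AutoregressiveGaugeAllClosingColdExact

/-!
# LatticeQCDFlow / Scaling — the certified cost of a measurement with the exact all-closing conditioner (`A = Z/∏_ℓ c_{#C_ℓ}`): `R` independent coupled pairs time-averaged over `L` rounds after `k` discarded ones certify accuracy `ε` at confidence `1 − δ` for about `2(2/A − 1)·Var_π f·log(2/δ)/ε²` rounds in total (Hausdorff `G`)

HONEST FRAMING: exact (Metropolis-corrected) sampling algorithms for lattice gauge theory;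
figures of merit are autocorrelation/cost numbers at stated couplings and volumes; no
continuum-physics claim.

Venture `LatticeQCDFlow` (cell pub-lqcd), topic `Scaling`, FANOUT row 30 (lean-1, GEN-39) — OUR WORK, the gauge instance of this
generation's abstract `Exactness/IMHCoupledTimeAverageBernstein` for the exact all-closing conditioner (`A = Z/∏_ℓ c_{#C_ℓ}`).  Setting as in
`Scaling/AutoregressiveGauge…CommonRandomNumbers` (GEN-36): the CRN pair kernel `K̂` feeds the SAME proposals and uniforms to two runs;
`A` is the sampler's acceptance at the cold configuration (displayed), `1/A` its cold weight.
Mutually independent coupled pairs from ONE initial coupling `ν̂`; the time-averaged coupled estimate `H̄_L(Z_j)` over the window `[k, k + L)` with `N` corrections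
per time; `a ≤ f ≤ c`; `D = max(π f − a, c − π f)`.  The window read-out variance is an autocorrelation quantity, `≤ σ_L² = (2/A − 1)Var_π f/L + (1 − A)^k D²`
(GEN-35's any-start window MSE read on the pair chain), so Bernstein gives:

* **`allClosing_crnAvg_burnIn_bernstein_cost`** — `P(|R⁻¹Σ_{j<R} H̄_L(Z_j) − π f| ≥ ε + (1 − A)^k(c − a)) ≤ 2·exp(−Rε²/(2(σ_L² + (c − a)ε/3))) + R·(1 − A)^k·ν̂(U_0 ≠ U′_0)`
  (assuming `σ_L² > 0`): exponent `R·L·ε²/(2(2/A − 1)Var_π f)·(1 + o(1))` — a total of about `2(2/A − 1)·Var_π f·log(2/δ)/ε²` update rounds certifies accuracy `ε` at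
  confidence `1 − δ` (GEN-39's median certificate: `8(2/A − 1)Var_π f/s²` rounds × `8 log(1/δ)` pairs).

NOT CLAIMED: the optimal split between `R` and `L`; an empirical variance; any value of `A`.  No `def`, no `sorry`, nothing cited as a fact.
-/

noncomputable section

namespace Summit.Ventures.LatticeQCDFlow.Theory2.Autoregressive

open MeasureTheory ProbabilityTheory Function Finset
open scoped ENNReal unitInterval
open Literature.MathematicalPhysics.QuantumFieldTheory Literature.MathematicalPhysics.QuantumLattice
open Summit.Ventures.LatticeQCDFlow.Exactness Summit.Ventures.LatticeQCDFlow.Scoring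

variable {d L : ℕ} [NeZero L] {G : Type*} [Group G] [TopologicalSpace G] [IsTopologicalGroup G]
  [CompactSpace G] [SecondCountableTopology G] [MeasurableSpace G] [BorelSpace G]

/-- **THE CERTIFIED COST OF A MEASUREMENT** (the exact all-closing conditioner (`A = Z/∏_ℓ c_{#C_ℓ}`); Hausdorff `G`). [ours] -/
theorem allClosing_crnAvg_burnIn_bernstein_cost [T2Space G] [MeasurableSingletonClass G] (hL : 2 ≤ L) {w : G → ℝ} (hw : Continuous w) {m M : ℝ} (hm0 : 0 < m)
    (hm : ∀ g, m ≤ w g) (hM : ∀ g, w g ≤ M) (hwinv : ∀ g, w g⁻¹ = w g)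
    (T : Finset (Edge d L)) (C : Edge d L → Finset (Plaquette d L))
    (hCne : ∀ ℓ ∈ T, (C ℓ).Nonempty)
    (hCe : ∀ ℓ ∈ T, ∀ p ∈ C ℓ, ℓ ∈ ({(p.1, p.2.1.1), (p.1.shift p.2.1.1, p.2.1.2),
        (p.1.shift p.2.1.2, p.2.1.1), (p.1, p.2.1.2)} : Finset (Edge d L)))
    (hdisj : ∀ ℓ ∈ T, ∀ ℓ' ∈ T, ℓ ≠ ℓ' → Disjoint (C ℓ) (C ℓ'))
    (hcover : ∀ p : Plaquette d L, ∃ ℓ ∈ T, p ∈ C ℓ)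
    (π q : Measure (GaugeConfig d L G)) [IsProbabilityMeasure π] [IsProbabilityMeasure q]
    (hπ : π = (Measure.pi fun _ : Edge d L => haarProbability G).withDensity fun U =>
      ENNReal.ofReal ((∏ p : Plaquette d L, w (plaquetteHolonomy U p.1 p.2.1.1 p.2.1.2)) /
        ∫ V, ∏ p : Plaquette d L, w (plaquetteHolonomy V p.1 p.2.1.1 p.2.1.2) ∂(Measure.pi fun _ : Edge d L => haarProbability G)))
    (hq : q = (Measure.pi fun _ : Edge d L => haarProbability G).withDensity fun U =>
      ENNReal.ofReal (∏ ℓ ∈ T, (∏ p ∈ C ℓ, w (plaquetteHolonomy U p.1 p.2.1.1 p.2.1.2)) /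
          (∫ v, ∏ p ∈ C ℓ, w (plaquetteHolonomy (update U ℓ v) p.1 p.2.1.1 p.2.1.2) ∂(haarProbability G))))
    [Fact (Measurable (fun U =>
        (((∫ V, ∏ p : Plaquette d L, w (plaquetteHolonomy V p.1 p.2.1.1 p.2.1.2) ∂(Measure.pi fun _ : Edge d L => haarProbability G)) /
          ∏ ℓ ∈ T, (∫ v, ∏ p ∈ C ℓ, w (plaquetteHolonomy (update U ℓ v) p.1 p.2.1.1 p.2.1.2) ∂(haarProbability G))))⁻¹))]
    (Khat : Kernel (GaugeConfig d L G × GaugeConfig d L G) (GaugeConfig d L G × GaugeConfig d L G))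
    [IsMarkovKernel Khat]
    (hK : ∀ z : GaugeConfig d L G × GaugeConfig d L G, Khat z =
      (q.prod (volume : Measure unitInterval)).map (fun p : GaugeConfig d L G × unitInterval =>
        ((if (p.2 : ℝ) * (fun U =>
        (((∫ V, ∏ p : Plaquette d L, w (plaquetteHolonomy V p.1 p.2.1.1 p.2.1.2) ∂(Measure.pi fun _ : Edge d L => haarProbability G)) /
          ∏ ℓ ∈ T, (∫ v, ∏ p ∈ C ℓ, w (plaquetteHolonomy (update U ℓ v) p.1 p.2.1.1 p.2.1.2) ∂(haarProbability G))))⁻¹) z.1 ≤ (fun U =>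
        (((∫ V, ∏ p : Plaquette d L, w (plaquetteHolonomy V p.1 p.2.1.1 p.2.1.2) ∂(Measure.pi fun _ : Edge d L => haarProbability G)) /
          ∏ ℓ ∈ T, (∫ v, ∏ p ∈ C ℓ, w (plaquetteHolonomy (update U ℓ v) p.1 p.2.1.1 p.2.1.2) ∂(haarProbability G))))⁻¹) p.1 then p.1 else z.1),
          (if (p.2 : ℝ) * (fun U =>
        (((∫ V, ∏ p : Plaquette d L, w (plaquetteHolonomy V p.1 p.2.1.1 p.2.1.2) ∂(Measure.pi fun _ : Edge d L => haarProbability G)) /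
          ∏ ℓ ∈ T, (∫ v, ∏ p ∈ C ℓ, w (plaquetteHolonomy (update U ℓ v) p.1 p.2.1.1 p.2.1.2) ∂(haarProbability G))))⁻¹) z.2 ≤ (fun U =>
        (((∫ V, ∏ p : Plaquette d L, w (plaquetteHolonomy V p.1 p.2.1.1 p.2.1.2) ∂(Measure.pi fun _ : Edge d L => haarProbability G)) /
          ∏ ℓ ∈ T, (∫ v, ∏ p ∈ C ℓ, w (plaquetteHolonomy (update U ℓ v) p.1 p.2.1.1 p.2.1.2) ∂(haarProbability G))))⁻¹) p.1 then p.1 else z.2))))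
{Ω' : Type*} {mΩ' : MeasurableSpace Ω'} {μ : Measure Ω'} [IsProbabilityMeasure μ]
    {Z : ℕ → Ω' → (ℕ → GaugeConfig d L G × GaugeConfig d L G)} (ν : Measure (GaugeConfig d L G × GaugeConfig d L G)) [IsProbabilityMeasure ν]
    {f : GaugeConfig d L G → ℝ} (hf : Measurable f) {a c : ℝ} (ha : ∀ x, a ≤ f x) (hc : ∀ x, f x ≤ c) (k N : ℕ) {Lw : ℕ} (hLw : Lw ≠ 0)
    (hZm : ∀ j, Measurable (Z j))
    (hlaw : ∀ j, μ.map (Z j) = Kernel.trajMeasure (X := fun _ : ℕ => GaugeConfig d L G × GaugeConfig d L G) ν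
      (fun n : ℕ => Khat.comap (fun h : (i : ↥(Finset.Iic n)) → GaugeConfig d L G × GaugeConfig d L G => h ⟨n, Finset.mem_Iic.2 le_rfl⟩)
        (measurable_pi_apply _)))
    (hind : iIndepFun Z μ)
    (hpos : 0 < (2 * (((∫ V, ∏ p : Plaquette d L, w (plaquetteHolonomy V p.1 p.2.1.1 p.2.1.2) ∂(Measure.pi fun _ : Edge d L => haarProbability G)) /
        ∏ ℓ ∈ T, ∫ h, w h ^ (C ℓ).card ∂(haarProbability G)))⁻¹ - 1) *
          (∫ x, (f x - ∫ z, f z ∂(π)) ^ 2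
            ∂(π)) / Lw +
        (1 - (((∫ V, ∏ p : Plaquette d L, w (plaquetteHolonomy V p.1 p.2.1.1 p.2.1.2) ∂(Measure.pi fun _ : Edge d L => haarProbability G)) /
        ∏ ℓ ∈ T, ∫ h, w h ^ (C ℓ).card ∂(haarProbability G)))) ^ k *
          (max (∫ z, f z ∂(π) - a)
            (c - ∫ z, f z ∂(π))) ^ 2)
    {ε : ℝ} (hε : 0 ≤ ε) {R : ℕ} (hR : 1 ≤ R) :
    μ.real {ω | ε + (1 - (((∫ V, ∏ p : Plaquette d L, w (plaquetteHolonomy V p.1 p.2.1.1 p.2.1.2) ∂(Measure.pi fun _ : Edge d L => haarProbability G)) /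
        ∏ ℓ ∈ T, ∫ h, w h ^ (C ℓ).card ∂(haarProbability G)))) ^ k * (c - a) ≤
        |(R : ℝ)⁻¹ * ∑ j ∈ range R, (∑ l ∈ range Lw, (f ((Z j ω (k + l)).2) +
            ∑ n ∈ range N, (f ((Z j ω (k + l + n)).1) - f ((Z j ω (k + l + n)).2)))) / Lw -
          ∫ x, f x ∂(π)|} ≤
      2 * Real.exp (-(R * ε ^ 2) / (2 * ((2 * (((∫ V, ∏ p : Plaquette d L, w (plaquetteHolonomy V p.1 p.2.1.1 p.2.1.2) ∂(Measure.pi fun _ : Edge d L => haarProbability G)) /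
        ∏ ℓ ∈ T, ∫ h, w h ^ (C ℓ).card ∂(haarProbability G)))⁻¹ - 1) *
          (∫ x, (f x - ∫ z, f z ∂(π)) ^ 2
            ∂(π)) / Lw +
        (1 - (((∫ V, ∏ p : Plaquette d L, w (plaquetteHolonomy V p.1 p.2.1.1 p.2.1.2) ∂(Measure.pi fun _ : Edge d L => haarProbability G)) /
        ∏ ℓ ∈ T, ∫ h, w h ^ (C ℓ).card ∂(haarProbability G)))) ^ k *
          (max (∫ z, f z ∂(π) - a)
            (c - ∫ z, f z ∂(π))) ^ 2 + (c - a) * ε / 3))) +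
        R * ((1 - (((∫ V, ∏ p : Plaquette d L, w (plaquetteHolonomy V p.1 p.2.1.1 p.2.1.2) ∂(Measure.pi fun _ : Edge d L => haarProbability G)) /
        ∏ ℓ ∈ T, ∫ h, w h ^ (C ℓ).card ∂(haarProbability G)))) ^ k * ν.real (Set.diagonal (GaugeConfig d L G))ᶜ) := by
  obtain ⟨hA, hρq, hmax, hρm, hρpos⟩ := allClosing_cold_acceptMass_eq hL hw hm0 hm hM hwinv T C hCne hCe hdisj hcover π q hπ hq
  set cold : GaugeConfig d L G := fun _ => (1 : G) with hcold
  set ρ : GaugeConfig d L G → ℝ := fun U =>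
    ((∫ V, ∏ p : Plaquette d L, w (plaquetteHolonomy V p.1 p.2.1.1 p.2.1.2) ∂(Measure.pi fun _ : Edge d L => haarProbability G)) /
      ∏ ℓ ∈ T, (∫ v, ∏ p ∈ C ℓ, w (plaquetteHolonomy (update U ℓ v) p.1 p.2.1.1 p.2.1.2) ∂(haarProbability G))) with hρ
  have hw0' : ∀ U, 0 < (ρ U)⁻¹ := fun U => inv_pos.2 (hρpos U)
  have hπ' : (q.withDensity fun U => ENNReal.ofReal (ρ U)⁻¹) = π := withDensity_inv_density hρm hρpos hρq
  haveI : IsProbabilityMeasure (q.withDensity fun U => ENNReal.ofReal (ρ U)⁻¹) := by rw [hπ']; infer_instance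
  have hone : ∫⁻ y, ENNReal.ofReal (ρ y)⁻¹ ∂q = ENNReal.ofReal 1 := by
    have h : π Set.univ = 1 := measure_univ
    rw [← hπ', withDensity_apply _ MeasurableSet.univ, Measure.restrict_univ] at h
    rw [h, ENNReal.ofReal_one]
  have hA' := imhAcceptMass_toReal_eq_of_forall_le (q := q) hw0' cold hmax zero_le_one hone
  have hrate : ((ρ cold)⁻¹)⁻¹ = ((∫ V, ∏ p : Plaquette d L, w (plaquetteHolonomy V p.1 p.2.1.1 p.2.1.2) ∂(Measure.pi fun _ : Edge d L => haarProbability G)) /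
        ∏ ℓ ∈ T, ∫ h, w h ^ (C ℓ).card ∂(haarProbability G)) := by
    rw [← hA, hA', one_div]
  rw [← hπ', show (((∫ V, ∏ p : Plaquette d L, w (plaquetteHolonomy V p.1 p.2.1.1 p.2.1.2) ∂(Measure.pi fun _ : Edge d L => haarProbability G)) /
        ∏ ℓ ∈ T, ∫ h, w h ^ (C ℓ).card ∂(haarProbability G)))⁻¹ = (ρ cold)⁻¹ from by rw [← hrate, inv_inv], ← hrate] at hpos
  have h := crnLagAvg_replicas_burnIn_bernstein_cost (q := q) hw0' hmax Khat hK ν hf ha hc k N hLw hZm hlaw hind hpos hε hR (x₀ := cold)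
  rw [hrate] at h
  rw [show (ρ cold)⁻¹ = (((∫ V, ∏ p : Plaquette d L, w (plaquetteHolonomy V p.1 p.2.1.1 p.2.1.2) ∂(Measure.pi fun _ : Edge d L => haarProbability G)) /
        ∏ ℓ ∈ T, ∫ h, w h ^ (C ℓ).card ∂(haarProbability G)))⁻¹ from by rw [← hrate, inv_inv]] at h
  rw [hπ'] at h
  exact h

end Summit.Ventures.LatticeQCDFlow.Theory2.Autoregressive

end
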